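import Summits.BirchSwinnertonDyer.BirchSwinnertonDyer.Theorems.EisensteinPrimesB11L3MainConjecture
import HarnessLib

/-!
# Row B11 (X2c, rank 1, Eisenstein, `p ‖ N`): Mazur's main conjecture at the pair from the L3 certificate in
# its COEFFICIENT reading (`[T^(1+e)]L ≠ 0` instead of `ord_{T=0} L = 1+e`) — the main-conjecture twins of
# k5-p3 g2's `B11L3.bsdp_of_cellC_of_{split,not_split}_of_thm16_of_l3CoeffCertificate` (cell `bsd-eis`, seat
# `bsd-eis-k5-c4` gen 10; route `EisensteinPrimes`, crux 4 `BSDpOnCellC` = stmt-BirchSwinnertonDyer-19034;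
# THEOREMS ONLY — no definition, no new named fact)

HONEST FRAMING (FULL-BSD rank-≤1 programme D-0033, cell `bsd-eis`, home `run/shared/lean/pub/bsd-eis/`).
Per-pair CONDITIONAL theorems: class-level inputs = registered PUBLISHED facts BY NAME (`hWu` Wuthrich 2014
Thm. 16, `hJs`/`hJn` Stein–Wuthrich 2013 Thm. 6.1, `hGZK`); per-pair inputs = instrument readings. Nothing
booked; no label or count moves; X2c stays CONSTRUCTION-SHAPED (crux 4 OPEN, stubs untouched); BSD proved for
no curve unconditionally.

WHY. k5-p3 g2 landed BOTH (i) the coefficient-reading `BSD(E,p)` doors (`Theorems/EisensteinPrimesB11L3Door.lean`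
§3, p545218: «the ORDER reading is THEORY + ONE COEFFICIENT» — `ϖ·L = T^e·ι(g)`, `g ∈ (f_E)`, `T^r ∣ f_E` give
`ord_{T=0} L ≥ r + e` as a THEOREM, so the instrument content of `ord_{T=0} L = r + e` is `[T^(r+e)]L ≠ 0`,
which is exactly what an exact Mazur–Tate coefficient read certifies) and (ii) «L3 ⟹ Mazur's main conjecture at
the pair» in the ORDER reading (`Theorems/EisensteinPrimesB11L3MainConjecture.lean`, p546788). This file is the
missing corner (ii)×(i): the main conjecture at the pair from the COEFFICIENT reading, so that a pair displayed on
the `…l3CoeffCertificate` doors (the «B11-L3CW» road, keys `HOME/k5-p3-g2/B11-L3CW-keys.v3a.tsv`; this seat's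
engine C v5 `v_p(b_{1+e})` column `HOME/k5-c4-g10/B11-L3W1b-vb2-keys.tsv`) carries `X2.MazurMainConjectureAt`
from the SAME binder. No new algebra: per datum the coefficient reading is turned into the order reading by
k5-p3's `B11L3.order_eq_of_coeff_ne_zero_of_engineShape` on Wuthrich's engine shape, and the cofactor is a unit by
k5-p3's `B11L3.isUnit_cofactor_of_leadingTerm_certificate` (Stein–Wuthrich's «unit quotient» remark, §8.2 p. 24 /
§11 p. 29).

* §1 `cellC_mazurMainConjectureAt_of_split_of_thm16_of_l3CoeffCertificate` — X2c, SPLIT: `CellC W p`, `split`,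
  `hcert` = VERBATIM the binder of `B11L3.bsdp_of_cellC_of_split_of_thm16_of_l3CoeffCertificate` ⟹
  `X2.MazurMainConjectureAt W p`.
* §2 `cellC_mazurMainConjectureAt_of_not_split_of_thm16_of_l3CoeffCertificate` — the non-split twin.
* §3 `bsdp_and_mazurMainConjectureAt_of_cellC_of_{split,not_split}_of_thm16_of_l3CoeffCertificate` — ONE
  coefficient certificate (+ `hsha : p ∤ #Ш_an`), both conclusions, composing with k5-p3's doors.

References: [SteinWuthrich2013] Thm. 6.1 (p. 20), §4.2, §8.2 (p. 24), §11 (p. 29); [Wuthrich2014] Thm. 16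
(p. 397); [Miller2011LMS] Def. 1.1, Prop. 7.6; [MazurTateTeitelbaum1986] §I.14.
-/

set_option autoImplicit false
set_option linter.dupNamespace false

noncomputable section

open scoped Classical MatrixGroups ModularForm

open WeierstrassCurve PowerSeries CongruenceSubgroup
  Literature.NumberTheory.EllipticCurves
  Literature.NumberTheory.EllipticCurves.ModularForms
  Literature.NumberTheory.EllipticCurves.Rank1Residual
  Literature.NumberTheory.EllipticCurves.Rank1Residual.Typed
  Literature.NumberTheory.EllipticCurves.Wuthrich2014
  Literature.NumberTheory.EllipticCurves.SteinWuthrich2013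
  Summit.BirchSwinnertonDyer.Rank1Residual
  Summit.BirchSwinnertonDyer.Rank1Residual.X2

namespace Summit.BirchSwinnertonDyer.BirchSwinnertonDyer.Theorems.B11L3

variable (W : WeierstrassCurve ℚ) [W.IsElliptic] [W.IsGloballyMinimal] (p : ℕ) [Fact p.Prime]

/-! ## §1 SPLIT `p ‖ N` -/

/-- **X2c, SPLIT `p ‖ N`: the L3 certificate in its COEFFICIENT reading (`[T²]L ≠ 0` and
`v_p(ϖ·[T²]L·log_p(γ_cyc)²·#tors²) = v_p(𝓛_p·∏c_v·Reg_p)`, VERBATIM the binder of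
`B11L3.bsdp_of_cellC_of_split_of_thm16_of_l3CoeffCertificate`) ⟹ Mazur's main conjecture at the pair.**
PUB by name: `hWu` (Wuthrich Thm. 16), `hJs` (Stein–Wuthrich Thm. 6.1 split), `hGZK`. Per datum: Wuthrich's
divisibility `ϖ·L = T·ι(h·f_E)`, `T^r ∣ f_E` (tree), `[T²]L ≠ 0` ⟹ `ord_{T=0} L = 2`
(`B11L3.order_eq_of_coeff_ne_zero_of_engineShape`), then `h ∈ Λˣ` (`B11L3.isUnit_cofactor_of_leadingTerm_certificate`).
[cite: SteinWuthrich2013, Thm. 6.1 (p. 20), §4.2 and §8.2 (p. 24)] [cite: Wuthrich2014, Thm. 16 (p. 397)]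
[cite: Miller2011LMS, Prop. 7.6] -/
theorem cellC_mazurMainConjectureAt_of_split_of_thm16_of_l3CoeffCertificate
    (hWu : thm16_charIdeal_dvd_multiplicative_of_reducible) (hJs : thm61_splitMultiplicative)
    (hGZK : rank_eq_analyticRank_of_analyticRank_le_one)
    (hc : CellC W p) (hsplit : W.HasSplitMultiplicativeReductionAtPrime p)
    (hcert : ∀ {N : ℕ} [NeZero N] (f : CuspForm (Gamma0 N) 2), IsNewformOf W f →
      ∀ (ϖ : ℚ), (ϖ : ℝ) * W.realPeriodRat = plusPeriod f →
      ∀ (L : PowerSeries ℚ_[p]), IsSplitMultPAdicLFunctionOf f p L →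
      ∀ (Dq : TateParameterData W p) (Dh : PAdicHeightData W p), IsSplitMultCanonical Dh Dq →
        PowerSeries.coeff 2 L ≠ 0 ∧
        (((ϖ : ℚ) : ℚ_[p]) * PowerSeries.coeff 2 L *
            (padicLog p (cyclotomicGenerator p) ^ 2 * (W.torsionOrder : ℚ_[p]) ^ 2)).valuation =
          (LInvariant Dq * (W.tamagawaProduct : ℚ_[p]) * padicRegulator Dh).valuation) :
    MazurMainConjectureAt W p := by
  obtain ⟨hr1, hp2, hred, -⟩ := hc
  intro κ γ hκ hγ hγ' N _ f hf D ϖ hϖ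
  haveI : Module.Finite (IwasawaAlgebra p) D.X := D.module_finite_holds hγ
  obtain ⟨hX, -, hKs⟩ := hWu W p hp2 hsplit.hasMultiplicativeReductionAtPrime hred hκ hγ hγ' hf D ϖ hϖ
  haveI : (Literature.NumberTheory.EllipticCurves.Module.charIdeal (IwasawaAlgebra p) D.X).IsPrincipal :=
    charIdeal_isPrincipal_holds p D.X
  obtain ⟨fE, hfE⟩ := Submodule.IsPrincipal.principal
    (Literature.NumberTheory.EllipticCurves.Module.charIdeal (IwasawaAlgebra p) D.X)
  have hchar : D.charIdeal = Ideal.span {fE} := hfE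
  have hrank : W.mordellWeilRank = 1 := by rw [(hGZK W hr1.le).1, hr1]
  have hϖ0 : ϖ ≠ 0 := by
    rintro rfl
    have hper : 0 < plusPeriod f := IsNewform0.plusPeriod_pos_holds hf.1 hf.coeffField_eq_bot
    rw [← hϖ, Rat.cast_zero, zero_mul] at hper
    exact lt_irrefl _ hper
  have hϖQ : ((ϖ : ℚ) : ℚ_[p]) ≠ 0 := by exact_mod_cast hϖ0
  refine ⟨hX, fE, hchar, fun hsplit' L hL ↦ ?_, fun hns _ _ ↦ absurd hsplit hns⟩
  obtain ⟨g, hgmem, hιg⟩ := hKs hsplit' L hL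
  have hgmem' : g ∈ Ideal.span {fE} := by rw [← hchar]; exact hgmem
  obtain ⟨h, hgh⟩ := Ideal.mem_span_singleton'.mp hgmem'
  obtain ⟨Dq⟩ := (nonempty_tateParameterData_iff_holds (W := W) (p := p)).mpr hsplit
  obtain ⟨Dh, hDh⟩ := exists_isSplitMultCanonical_holds W p hp2 Dq
  obtain ⟨hcoeff, hval⟩ := hcert f hf ϖ hϖ L hL Dq Dh hDh
  have hXk := X_pow_mordellWeilRank_dvd_of_charIdeal_eq_span W p hγ D hX hchar
  have h𝓛A : LInvariant Dq * (W.tamagawaProduct : ℚ_[p]) ≠ 0 :=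
    mul_ne_zero (LInvariant_ne_zero_holds Dq) (by exact_mod_cast (W.tamagawaProduct_pos').ne')
  -- the engine shape `ϖ·L = T¹·ι(h·f_E)`, and the order from the coefficient
  have hι : PowerSeries.C ((ϖ : ℚ) : ℚ_[p]) * L =
      PowerSeries.X ^ 1 * iwasawaToPowerSeries p (h * fE) := by
    rw [hgh, ← hιg, map_mul, pow_one]
    simp [iwasawaToPowerSeries, PowerSeries.map_X]
  have hordL : L.order = ((W.mordellWeilRank + 1 : ℕ) : ℕ∞) :=
    order_eq_of_coeff_ne_zero_of_engineShape p fE (h * fE) (Ideal.mem_span_singleton'.mpr ⟨h, rfl⟩) L _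
      hϖQ 1 W.mordellWeilRank hι hXk (by rw [hrank]; exact hcoeff)
  obtain ⟨hunit, -⟩ := isUnit_cofactor_of_leadingTerm_certificate W p fE h L _ hϖQ 1
    W.mordellWeilRank hι hordL _ _ (padicRegulator Dh) h𝓛A hXk
    (hJs.leadingTerm_shape hp2 Dq hκ hγ hγ' D hX hDh fE hchar) (by rw [hrank]; exact hval)
  refine ⟨hunit.unit, ?_⟩
  rw [IsUnit.unit_spec, mul_assoc, mul_comm fE h, hgh, hιg]

/-! ## §2 NON-split `p ‖ N` -/

/-- **X2c, NON-split `p ‖ N`: the L3 certificate in its COEFFICIENT reading (`[T¹]L ≠ 0` and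
`v_p(ϖ·[T¹]L·log_p(γ_cyc)·#tors²) = v_p(2·∏c_v·Reg_p)`, VERBATIM the binder of
`B11L3.bsdp_of_cellC_of_not_split_of_thm16_of_l3CoeffCertificate`) ⟹ Mazur's main conjecture at the pair.**
[cite: SteinWuthrich2013, Thm. 6.1 (p. 20), §3.1 (p. 9), §4.2 and §8.2 (p. 24)] [cite: Wuthrich2014, Thm. 16 (p. 397)]
[cite: Miller2011LMS, Prop. 7.6] -/
theorem cellC_mazurMainConjectureAt_of_not_split_of_thm16_of_l3CoeffCertificate
    (hWu : thm16_charIdeal_dvd_multiplicative_of_reducible) (hJn : thm61_nonsplitMultiplicative)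
    (hGZK : rank_eq_analyticRank_of_analyticRank_le_one)
    (hc : CellC W p) (hns : ¬ W.HasSplitMultiplicativeReductionAtPrime p)
    (hcert : ∀ {N : ℕ} [NeZero N] (f : CuspForm (Gamma0 N) 2), IsNewformOf W f →
      ∀ (ϖ : ℚ), (ϖ : ℝ) * W.realPeriodRat = plusPeriod f →
      ∀ (L : PowerSeries ℚ_[p]), IsMultPAdicLFunctionOf f p (-1) L →
      ∀ (q : ℚ_[p]), q ≠ 0 → ‖q‖ < 1 → tateJ q = (W.j : ℚ_[p]) →
      ∀ (Dh : PAdicHeightData W p), IsMultCanonical Dh q →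
        PowerSeries.coeff 1 L ≠ 0 ∧
        (((ϖ : ℚ) : ℚ_[p]) * PowerSeries.coeff 1 L *
            (padicLog p (cyclotomicGenerator p) ^ 1 * (W.torsionOrder : ℚ_[p]) ^ 2)).valuation =
          (2 * (W.tamagawaProduct : ℚ_[p]) * padicRegulator Dh).valuation) :
    MazurMainConjectureAt W p := by
  obtain ⟨hr1, hp2, hred, hmult⟩ := hc
  intro κ γ hκ hγ hγ' N _ f hf D ϖ hϖ
  haveI : Module.Finite (IwasawaAlgebra p) D.X := D.module_finite_holds hγ
  obtain ⟨hX, hKns, -⟩ := hWu W p hp2 hmult hred hκ hγ hγ' hf D ϖ hϖ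
  haveI : (Literature.NumberTheory.EllipticCurves.Module.charIdeal (IwasawaAlgebra p) D.X).IsPrincipal :=
    charIdeal_isPrincipal_holds p D.X
  obtain ⟨fE, hfE⟩ := Submodule.IsPrincipal.principal
    (Literature.NumberTheory.EllipticCurves.Module.charIdeal (IwasawaAlgebra p) D.X)
  have hchar : D.charIdeal = Ideal.span {fE} := hfE
  have hrank : W.mordellWeilRank = 1 := by rw [(hGZK W hr1.le).1, hr1]
  have hϖ0 : ϖ ≠ 0 := by
    rintro rfl
    have hper : 0 < plusPeriod f := IsNewform0.plusPeriod_pos_holds hf.1 hf.coeffField_eq_bot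
    rw [← hϖ, Rat.cast_zero, zero_mul] at hper
    exact lt_irrefl _ hper
  have hϖQ : ((ϖ : ℚ) : ℚ_[p]) ≠ 0 := by exact_mod_cast hϖ0
  refine ⟨hX, fE, hchar, fun hsplit _ _ ↦ absurd hsplit hns, fun hns' L hL ↦ ?_⟩
  obtain ⟨g, hgmem, hιg⟩ := hKns hns' L hL
  have hgmem' : g ∈ Ideal.span {fE} := by rw [← hchar]; exact hgmem
  obtain ⟨h, hgh⟩ := Ideal.mem_span_singleton'.mp hgmem'
  obtain ⟨q, ⟨hq0, hq1, hqj⟩, -⟩ := existsUnique_tateJ_eq_of_one_lt_norm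
    (one_lt_norm_j_of_hasMultiplicativeReductionAtPrime (W := W) (p := p) hmult)
  obtain ⟨Dh, hDh⟩ := exists_isMultCanonical_holds W p hp2 hmult hns q hq0 hq1 hqj
  obtain ⟨hcoeff, hval⟩ := hcert f hf ϖ hϖ L hL q hq0 hq1 hqj Dh hDh
  have hXk := X_pow_mordellWeilRank_dvd_of_charIdeal_eq_span W p hγ D hX hchar
  have h2A : (2 : ℚ_[p]) * (W.tamagawaProduct : ℚ_[p]) ≠ 0 :=
    mul_ne_zero two_ne_zero (by exact_mod_cast (W.tamagawaProduct_pos').ne')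
  -- the engine shape `ϖ·L = T⁰·ι(h·f_E)`, and the order from the coefficient
  have hι : PowerSeries.C ((ϖ : ℚ) : ℚ_[p]) * L =
      PowerSeries.X ^ 0 * iwasawaToPowerSeries p (h * fE) := by
    rw [hgh, pow_zero, one_mul, hιg]
  have hordL : L.order = ((W.mordellWeilRank + 0 : ℕ) : ℕ∞) :=
    order_eq_of_coeff_ne_zero_of_engineShape p fE (h * fE) (Ideal.mem_span_singleton'.mpr ⟨h, rfl⟩) L _
      hϖQ 0 W.mordellWeilRank hι hXk (by rw [hrank]; exact hcoeff)
  obtain ⟨hunit, -⟩ := isUnit_cofactor_of_leadingTerm_certificate W p fE h L _ hϖQ 0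
    W.mordellWeilRank hι hordL _ _ (padicRegulator Dh) h2A hXk
    (hJn.leadingTerm_shape hp2 hmult hns hq0 hq1 hqj hκ hγ hγ' D hX hDh fE hchar)
    (by rw [hrank, Nat.add_zero]; exact hval)
  refine ⟨hunit.unit, ?_⟩
  rw [IsUnit.unit_spec, mul_comm fE h, hgh, hιg]

/-! ## §3 ONE coefficient certificate, both conclusions -/

/-- **X2c, SPLIT `p ‖ N` — ONE coefficient certificate (+ `p ∤ #Ш_an`): `BSD(E,p)` (k5-p3's
`…l3CoeffCertificate` door) AND Mazur's main conjecture at the pair (§1).** [cite: Wuthrich2014, Thm. 16 (p. 397)]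
[cite: SteinWuthrich2013, Thm. 6.1 (p. 20) and §4.2] [cite: Miller2011LMS, Def. 1.1 and Prop. 7.6] -/
theorem bsdp_and_mazurMainConjectureAt_of_cellC_of_split_of_thm16_of_l3CoeffCertificate
    (hWu : thm16_charIdeal_dvd_multiplicative_of_reducible) (hJs : thm61_splitMultiplicative)
    (hGZ : GrossZagier1986_thm_I_7_3) (hGZK : rank_eq_analyticRank_of_analyticRank_le_one)
    (hpar : nonempty_modularParametrizationData)
    (hc : CellC W p) (hsplit : W.HasSplitMultiplicativeReductionAtPrime p)
    (hcert : ∀ {N : ℕ} [NeZero N] (f : CuspForm (Gamma0 N) 2), IsNewformOf W f →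
      ∀ (ϖ : ℚ), (ϖ : ℝ) * W.realPeriodRat = plusPeriod f →
      ∀ (L : PowerSeries ℚ_[p]), IsSplitMultPAdicLFunctionOf f p L →
      ∀ (Dq : TateParameterData W p) (Dh : PAdicHeightData W p), IsSplitMultCanonical Dh Dq →
        PowerSeries.coeff 2 L ≠ 0 ∧
        (((ϖ : ℚ) : ℚ_[p]) * PowerSeries.coeff 2 L *
            (padicLog p (cyclotomicGenerator p) ^ 2 * (W.torsionOrder : ℚ_[p]) ^ 2)).valuation =
          (LInvariant Dq * (W.tamagawaProduct : ℚ_[p]) * padicRegulator Dh).valuation)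
    (hsha : ∀ s : ℚ, shaAn W = (s : ℂ) → padicValRat p s = 0) :
    BSDp W p ∧ MazurMainConjectureAt W p :=
  ⟨bsdp_of_cellC_of_split_of_thm16_of_l3CoeffCertificate W p hWu hJs hGZ hGZK hpar hc hsplit hcert hsha,
    cellC_mazurMainConjectureAt_of_split_of_thm16_of_l3CoeffCertificate W p hWu hJs hGZK hc hsplit hcert⟩

/-- **X2c, NON-split `p ‖ N` — ONE coefficient certificate (+ `p ∤ #Ш_an`): `BSD(E,p)` AND Mazur's main
conjecture at the pair (§2).** [cite: Wuthrich2014, Thm. 16 (p. 397)]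
[cite: SteinWuthrich2013, Thm. 6.1 (p. 20), §3.1 (p. 9), §4.2] [cite: Miller2011LMS, Def. 1.1 and Prop. 7.6] -/
theorem bsdp_and_mazurMainConjectureAt_of_cellC_of_not_split_of_thm16_of_l3CoeffCertificate
    (hWu : thm16_charIdeal_dvd_multiplicative_of_reducible) (hJn : thm61_nonsplitMultiplicative)
    (hGZ : GrossZagier1986_thm_I_7_3) (hGZK : rank_eq_analyticRank_of_analyticRank_le_one)
    (hpar : nonempty_modularParametrizationData)
    (hc : CellC W p) (hns : ¬ W.HasSplitMultiplicativeReductionAtPrime p)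
    (hcert : ∀ {N : ℕ} [NeZero N] (f : CuspForm (Gamma0 N) 2), IsNewformOf W f →
      ∀ (ϖ : ℚ), (ϖ : ℝ) * W.realPeriodRat = plusPeriod f →
      ∀ (L : PowerSeries ℚ_[p]), IsMultPAdicLFunctionOf f p (-1) L →
      ∀ (q : ℚ_[p]), q ≠ 0 → ‖q‖ < 1 → tateJ q = (W.j : ℚ_[p]) →
      ∀ (Dh : PAdicHeightData W p), IsMultCanonical Dh q →
        PowerSeries.coeff 1 L ≠ 0 ∧
        (((ϖ : ℚ) : ℚ_[p]) * PowerSeries.coeff 1 L *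
            (padicLog p (cyclotomicGenerator p) ^ 1 * (W.torsionOrder : ℚ_[p]) ^ 2)).valuation =
          (2 * (W.tamagawaProduct : ℚ_[p]) * padicRegulator Dh).valuation)
    (hsha : ∀ s : ℚ, shaAn W = (s : ℂ) → padicValRat p s = 0) :
    BSDp W p ∧ MazurMainConjectureAt W p :=
  ⟨bsdp_of_cellC_of_not_split_of_thm16_of_l3CoeffCertificate W p hWu hJn hGZ hGZK hpar hc hns hcert hsha,
    cellC_mazurMainConjectureAt_of_not_split_of_thm16_of_l3CoeffCertificate W p hWu hJn hGZK hc hns hcert⟩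

end Summit.BirchSwinnertonDyer.BirchSwinnertonDyer.Theorems.B11L3

end
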